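import Mathlib.Algebra.Order.Floor.Semiring
import Literature.ModelTheory.PseudofiniteFields.CountingDimensionThresholds
import Literature.ModelTheory.PseudofiniteFields.DefinablePredicates
import Literature.ModelTheory.PseudofiniteFields.AlgebraicBoundedness
import Literature.ModelTheory.PseudofiniteFields.DefinableExponentialSums
import HarnessLib

/-!
# The fibre-counting dimension of definable sets: formulas, thresholds, pseudo-finite fields

Topic `Literature/ModelTheory/PseudofiniteFields`.  Companion of `CountingDimension.lean`
(intrinsic predicate `DimAtLeast`) and `CountingDimensionThresholds.lean` (thresholded
predicate `CDimAtLeast Cs`, counting estimates in finite fields).  For a DEFINABLE family of sets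
`X = φ(K^n; v)` (`defSet φ K v`, `φ` a ring formula with set variables `Fin n` and parameter
variables `γ`):

* `exists_formula_cDimAtLeast` — "`CDimAtLeast Cs n (φ(K^n; v)) e`" is ONE ring formula in
  `v`, uniformly in the field (with the fibre / small-fibre-base / large-fibre-base formulas);
* `exists_goodThresholds` — from the Main Theorem of
  [ChatzidakisVanDenDriesMacintyre1992] (named fact `ChatzidakisVanDenDriesMacintyre1992_mainTheorem`,
  through its size dichotomy `card_le_or_le`): for finitely many families there are COMMON
  thresholds `Cs` and `δ > 0` that are good (`GoodThresholds`) in every finite field;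
* in a PSEUDO-FINITE field `K` (an infinite model of the theory of finite fields), for good
  thresholds: a fibre with more than `Cs k` points is infinite (`infinite_lastFibre_of_hasMoreThan`,
  algebraic boundedness by transfer), hence the intrinsic and the thresholded dimensions AGREE
  on definable sets (`dimAtLeast_iff_cDimAtLeast`) — so `DimAtLeast` is first-order there and
  transfers to counting in finite fields — and the intrinsic dimension of a definable set is
  invariant under PERMUTATIONS OF THE COORDINATES (`dimAtLeast_preimage_perm_iff`; false for
  arbitrary sets), by transfer of `|σX| = |X|` through the counting estimates.

## References

* [ChatzidakisVanDenDriesMacintyre1992] Z. Chatzidakis, L. van den Dries, A. Macintyre,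
  Definable sets over finite fields, J. reine angew. Math. 427 (1992) 107–135, Main Theorem,
  (2.7), §3 (dimension and measure of definable sets).
-/

namespace Literature.ModelTheory.PseudofiniteFields

open FirstOrder FirstOrder.Language FirstOrder.Ring

section DefSet

variable {n : ℕ} {γ : Type}

/-- The set `φ(K^n; v) = {x ∈ K^n | K ⊨ φ(x, v)}` defined by a ring formula `φ` (set variables
`Fin n`, parameter variables `γ`) at the parameters `v`. [folklore] -/
def defSet (φ : Language.ring.Formula (Fin n ⊕ γ)) (K : Type) [Field K] [CompatibleRing K]
    (v : γ → K) : Set (Fin n → K) :=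
  {x | φ.Realize (Sum.elim x v)}

/-- Membership in a definable set. [folklore] -/
@[simp] theorem mem_defSet (φ : Language.ring.Formula (Fin n ⊕ γ)) (K : Type) [Field K]
    [CompatibleRing K] (v : γ → K) (x : Fin n → K) :
    x ∈ defSet φ K v ↔ φ.Realize (Sum.elim x v) :=
  Iff.rfl

end DefSet

/-! ### Definability of fibres, bases and the thresholded dimension -/

section Formulas

variable {α γ : Type} {n : ℕ}

/-- Injectivity of a finite tuple of variables is definable. [folklore] -/
theorem definable_injective₁ {ι : Type} [Finite ι] (f : ι → α) :
    ∃ θ : Language.ring.Formula α, ∀ (K : Type) [Field K] [CompatibleRing K] (v : α → K),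
      θ.Realize v ↔ Function.Injective fun j => v (f j) := by
  obtain ⟨θ, hθ⟩ := definable_injective (fun (j : ι) (_ : Unit) => f j)
  refine ⟨θ, fun K _ _ v => (hθ K v).trans ⟨fun h j j' hjj' => h (funext fun _ => hjj'),
    fun h j j' hjj' => h (congrFun hjj' ())⟩⟩

/-- **Membership in a fibre is definable**: for `φ(x; v)` with `x ∈ K^{n+1}`, the predicate
"`V ft ∈` the fibre of `φ(K^{n+1}; V ∘ fv)` over `V ∘ fp`" of a valuation `V` is one ring
formula. [folklore] -/
theorem definable_mem_lastFibre (φ : Language.ring.Formula (Fin (n + 1) ⊕ γ)) (fp : Fin n → α)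
    (ft : α) (fv : γ → α) :
    ∃ θ : Language.ring.Formula α, ∀ (K : Type) [Field K] [CompatibleRing K] (V : α → K),
      θ.Realize V ↔ V ft ∈ lastFibre (defSet φ K fun g => V (fv g)) fun i => V (fp i) := by
  obtain ⟨θ, hθ⟩ := definable_realize₂ φ (Fin.snoc fp ft : Fin (n + 1) → α) fv
  refine ⟨θ, fun K _ _ V => (hθ K V).trans ?_⟩
  rw [mem_lastFibre, mem_defSet]
  refine Iff.of_eq (congrArg _ (congrArg₂ _ ?_ rfl))
  change V ∘ Fin.snoc fp ft = _
  rw [Fin.comp_snoc]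
  rfl

/-- **"The fibre has more than `C` points" is definable.** [folklore] -/
theorem definable_hasMoreThan_lastFibre (C : ℕ) (φ : Language.ring.Formula (Fin (n + 1) ⊕ γ))
    (fp : Fin n → α) (fv : γ → α) :
    ∃ θ : Language.ring.Formula α, ∀ (K : Type) [Field K] [CompatibleRing K] (V : α → K),
      θ.Realize V ↔
        HasMoreThan C (lastFibre (defSet φ K fun g => V (fv g)) fun i => V (fp i)) := by
  unfold HasMoreThan
  refine definable_exists ?_
  refine definable_and (definable_injective₁ _) ?_
  exact definable_iInf fun j => definable_mem_lastFibre φ _ _ _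

/-- **"The fibre is nonempty" is definable.** [folklore] -/
theorem definable_nonempty_lastFibre (φ : Language.ring.Formula (Fin (n + 1) ⊕ γ))
    (fp : Fin n → α) (fv : γ → α) :
    ∃ θ : Language.ring.Formula α, ∀ (K : Type) [Field K] [CompatibleRing K] (V : α → K),
      θ.Realize V ↔ (lastFibre (defSet φ K fun g => V (fv g)) fun i => V (fp i)).Nonempty := by
  obtain ⟨θ, hθ⟩ := definable_exists (α := α) (β := Unit)
    (P := fun K _ _ V w => w () ∈ lastFibre (defSet φ K fun g => V (fv g)) fun i => V (fp i))
    (definable_mem_lastFibre φ _ _ _)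
  refine ⟨θ, fun K _ _ V => (hθ K V).trans ⟨fun ⟨w, hw⟩ => ⟨_, hw⟩, fun ⟨t, ht⟩ => ⟨fun _ => t, ht⟩⟩⟩

/-- **The base of large fibres of a definable family is a definable family** (same
parameters). [folklore] -/
theorem exists_formula_cinfBase (C : ℕ) (φ : Language.ring.Formula (Fin (n + 1) ⊕ γ)) :
    ∃ ψ : Language.ring.Formula (Fin n ⊕ γ), ∀ (K : Type) [Field K] [CompatibleRing K]
      (v : γ → K), defSet ψ K v = cinfBase C (defSet φ K v) := by
  obtain ⟨θ, hθ⟩ := definable_hasMoreThan_lastFibre C φ (Sum.inl : Fin n → Fin n ⊕ γ) Sum.inr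
  refine ⟨θ, fun K _ _ v => Set.ext fun p => ?_⟩
  rw [mem_defSet, hθ, mem_cinfBase]
  rfl

/-- **The base of small nonempty fibres of a definable family is a definable family.**
[folklore] -/
theorem exists_formula_cfinBase (C : ℕ) (φ : Language.ring.Formula (Fin (n + 1) ⊕ γ)) :
    ∃ ψ : Language.ring.Formula (Fin n ⊕ γ), ∀ (K : Type) [Field K] [CompatibleRing K]
      (v : γ → K), defSet ψ K v = cfinBase C (defSet φ K v) := by
  obtain ⟨θ, hθ⟩ := definable_and
    (definable_nonempty_lastFibre φ (Sum.inl : Fin n → Fin n ⊕ γ) Sum.inr)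
    (definable_not (definable_hasMoreThan_lastFibre C φ (Sum.inl : Fin n → Fin n ⊕ γ) Sum.inr))
  refine ⟨θ, fun K _ _ v => Set.ext fun p => ?_⟩
  rw [mem_defSet, hθ, mem_cfinBase]
  rfl

/-- **The thresholded dimension of a definable family is definable**: for every `e` there is
one ring formula `θ_e(v)` with `K ⊨ θ_e(v) ↔ CDimAtLeast Cs n (φ(K^n; v)) e` in every field.
[folklore] -/
theorem exists_formula_cDimAtLeast (Cs : ℕ → ℕ) :
    ∀ (n : ℕ) (φ : Language.ring.Formula (Fin n ⊕ γ)) (e : ℕ),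
      ∃ θ : Language.ring.Formula γ, ∀ (K : Type) [Field K] [CompatibleRing K] (v : γ → K),
        θ.Realize v ↔ CDimAtLeast Cs n (defSet φ K v) e
  | 0, φ, e => by
    -- `X ≠ ∅ ∧ e = 0`
    obtain ⟨θ, hθ⟩ := definable_exists (α := γ) (β := Fin 0)
      (P := fun K _ _ v x => φ.Realize (Sum.elim x v)) (definable_realize₂ φ Sum.inr Sum.inl)
    by_cases he : e = 0
    · refine ⟨θ, fun K _ _ v => (hθ K v).trans ?_⟩
      rw [cDimAtLeast_zero_level]
      exact ⟨fun ⟨x, hx⟩ => ⟨⟨x, hx⟩, he⟩, fun ⟨⟨x, hx⟩, _⟩ => ⟨x, hx⟩⟩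
    · refine ⟨⊥, fun K _ _ v => ?_⟩
      rw [cDimAtLeast_zero_level]
      exact ⟨fun h => (Formula.realize_bot.1 h).elim, fun h => absurd h.2 he⟩
  | n + 1, φ, e => by
    obtain ⟨ψ₀, hψ₀⟩ := exists_formula_cfinBase (Cs n) φ
    obtain ⟨ψ₁, hψ₁⟩ := exists_formula_cinfBase (Cs n) φ
    obtain ⟨θ₀, hθ₀⟩ := exists_formula_cDimAtLeast Cs n ψ₀ e
    obtain ⟨θ₁, hθ₁⟩ := exists_formula_cDimAtLeast Cs n ψ₁ (e - 1)
    refine ⟨θ₀ ⊔ θ₁, fun K _ _ v => ?_⟩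
    rw [Formula.realize_sup, hθ₀, hθ₁, hψ₀, hψ₁, cDimAtLeast_succ]

/-- **The fibre as a definable subset of `K^1`** (for the counting theorem, which is stated for
sets of tuples): parameters `(p, v)`. [folklore] -/
theorem exists_formula_lastFibre (φ : Language.ring.Formula (Fin (n + 1) ⊕ γ)) :
    ∃ ψ : Language.ring.Formula (Fin 1 ⊕ (Fin n ⊕ γ)), ∀ (K : Type) [Field K] [CompatibleRing K]
      (v : γ → K) (p : Fin n → K),
      defSet ψ K (Sum.elim p v) = {x : Fin 1 → K | x 0 ∈ lastFibre (defSet φ K v) p} := by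
  obtain ⟨θ, hθ⟩ := definable_mem_lastFibre φ
    (fun i => (Sum.inr (Sum.inl i) : Fin 1 ⊕ (Fin n ⊕ γ))) (Sum.inl 0) fun g => Sum.inr (Sum.inr g)
  refine ⟨θ, fun K _ _ v p => Set.ext fun x => ?_⟩
  rw [mem_defSet, hθ]
  rfl

/-- The preimage of `S ⊆ K` in `K^1` has the same number of points. [folklore] -/
theorem ncard_setOf_apply_zero_mem {K : Type*} (S : Set K) :
    {x : Fin 1 → K | x 0 ∈ S}.ncard = S.ncard := by
  have hinj : Function.Injective fun x : Fin 1 → K => x 0 := fun x y h =>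
    funext fun i => by rw [Fin.fin_one_eq_zero i]; exact h
  have hrange : S ⊆ Set.range fun x : Fin 1 → K => x 0 := fun t _ => ⟨fun _ => t, rfl⟩
  exact Set.ncard_preimage_of_injective_subset_range hinj hrange

/-- A definable set permuted: `{x | x ∘ σ ∈ φ(K^n; v)}` is `φ^σ(K^n; v)` for the relabelled
formula `φ^σ = φ.relabel (Sum.map σ id)`. [folklore] -/
theorem defSet_relabel_perm (φ : Language.ring.Formula (Fin n ⊕ γ)) (σ : Equiv.Perm (Fin n))
    (K : Type) [Field K] [CompatibleRing K] (v : γ → K) :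
    defSet (φ.relabel (Sum.map σ id)) K v = {x | x ∘ σ ∈ defSet φ K v} := by
  ext x
  rw [mem_defSet, Formula.realize_relabel, Set.mem_setOf_eq, mem_defSet]
  refine Iff.of_eq (congrArg _ (funext fun i => ?_))
  cases i <;> rfl

end Formulas

/-! ### Good thresholds exist for definable families (CDM) -/

section Thresholds

variable {γ : Type} [Finite γ]

/-- **The CDM size dichotomy for an arbitrary finite parameter type**, in terms of the point
count of the definable set (any compatible ring structure on the finite field): for every
`ψ(x; v)` there are `C` and `δ > 0` with `|ψ(F^m; v)| ≤ C` or `|ψ(F^m; v)| ≥ δ |F|`.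
[cite: ChatzidakisVanDenDriesMacintyre1992, Main Theorem] -/
theorem cdm_ncard_le_or_le (hCDM : ChatzidakisVanDenDriesMacintyre1992_mainTheorem) {m : ℕ}
    (ψ : Language.ring.Formula (Fin m ⊕ γ)) :
    ∃ C δ : ℝ, 0 < δ ∧ ∀ (F : Type) [Field F] [Fintype F] [CompatibleRing F] (v : γ → F),
      ((defSet ψ F v).ncard : ℝ) ≤ C ∨
        δ * (Fintype.card F : ℝ) ≤ ((defSet ψ F v).ncard : ℝ) := by
  obtain ⟨N, ⟨e⟩⟩ := Finite.exists_equiv_fin γ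
  obtain ⟨C, δ, hδ, h⟩ := hCDM.card_le_or_le m N (ψ.relabel (Sum.map id e))
  refine ⟨C, δ, hδ, fun F _ _ _ v => ?_⟩
  have hcard : definableCard F (ψ.relabel (Sum.map id e)) (v ∘ e.symm) = (defSet ψ F v).ncard := by
    rw [definableCard_def, ← Nat.card_coe_set_eq]
    refine Nat.card_congr (Equiv.subtypeEquivRight fun x => ?_)
    rw [mem_defSet, realize_iff_of_compatibleRing ψ (Sum.elim x v)]
    letI := compatibleRingOfRing F
    rw [Formula.realize_relabel]
    refine Iff.of_eq (congrArg _ (funext fun i => ?_))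
    rcases i with i | g
    · rfl
    · simp
  have := h F (v ∘ e.symm)
  rwa [hcard] at this

/-- A finite family of reals has a common natural upper bound. [folklore] -/
theorem exists_nat_ge_forall {ι : Type} [Finite ι] (C : ι → ℝ) : ∃ c₀ : ℕ, ∀ i, C i ≤ c₀ := by
  classical
  haveI := Fintype.ofFinite ι
  refine ⟨Finset.univ.sup fun i => ⌈C i⌉₊, fun i => (Nat.le_ceil (C i)).trans ?_⟩
  exact_mod_cast Finset.le_sup (f := fun i => ⌈C i⌉₊) (Finset.mem_univ i)

/-- A finite family of positive reals has a common positive lower bound `≤ 1`. [folklore] -/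
theorem exists_pos_le_forall {ι : Type} [Finite ι] (δ : ι → ℝ) (hδ : ∀ i, 0 < δ i) :
    ∃ δ₀ : ℝ, 0 < δ₀ ∧ δ₀ ≤ 1 ∧ ∀ i, δ₀ ≤ δ i := by
  by_cases hne : Nonempty ι
  · obtain ⟨i₀, hi₀⟩ := Finite.exists_min δ
    exact ⟨min 1 (δ i₀), lt_min one_pos (hδ i₀), min_le_left _ _,
      fun i => (min_le_right _ _).trans (hi₀ i)⟩
  · exact ⟨1, one_pos, le_rfl, fun i => (hne ⟨i⟩).elim⟩

/-- **Good thresholds exist, uniformly, for finitely many definable families** (induction on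
the number of set variables; the threshold at the top level is a natural number above the CDM
constants of all the fibre families, and the lower levels serve the small-fibre and large-fibre
bases of all the families at once). [cite: ChatzidakisVanDenDriesMacintyre1992, Main Theorem] -/
theorem exists_goodThresholds (hCDM : ChatzidakisVanDenDriesMacintyre1992_mainTheorem) :
    ∀ (n : ℕ) {ι : Type} [Finite ι] (φ : ι → Language.ring.Formula (Fin n ⊕ γ)),
      ∃ (Cs : ℕ → ℕ) (δ : ℝ), 0 < δ ∧ δ ≤ 1 ∧
        ∀ (i : ι) (F : Type) [Field F] [Fintype F] [CompatibleRing F] (v : γ → F),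
          GoodThresholds Cs δ n (defSet (φ i) F v)
  | 0, ι, _, φ => ⟨fun _ => 0, 1, one_pos, le_rfl, fun i F _ _ _ v => trivial⟩
  | n + 1, ι, _, φ => by
    -- the fibre families and their CDM constants
    choose ψ hψ using fun i => exists_formula_lastFibre (φ i)
    choose C δ hδ hdich using fun i => cdm_ncard_le_or_le hCDM (ψ i)
    obtain ⟨c₀, hc₀⟩ := exists_nat_ge_forall C
    obtain ⟨δ₁, hδ₁, hδ₁1, hδ₁le⟩ := exists_pos_le_forall δ hδ
    -- the base families with threshold `c₀`, served by common thresholds below level `n`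
    choose ψ₀ hψ₀ using fun i => exists_formula_cfinBase c₀ (φ i)
    choose ψ₁ hψ₁ using fun i => exists_formula_cinfBase c₀ (φ i)
    obtain ⟨Cs', δ', hδ', -, hgood'⟩ := exists_goodThresholds hCDM n (Sum.elim ψ₀ ψ₁)
    have hlt : ∀ k, k < n → Function.update Cs' n c₀ k = Cs' k := fun k hk =>
      Function.update_of_ne (Nat.ne_of_lt hk) _ _
    refine ⟨Function.update Cs' n c₀, min δ₁ δ', lt_min hδ₁ hδ', (min_le_left _ _).trans hδ₁1,
      fun i F _ _ _ v => ?_⟩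
    rw [goodThresholds_succ, Function.update_self]
    refine ⟨fun p hp => ?_, ?_, ?_⟩
    · -- a fibre with more than `c₀ ≥ C_i` points has at least `δ_i q ≥ δ q` points
      have hfib : ((defSet (ψ i) F (Sum.elim p v)).ncard : ℝ) =
          ((lastFibre (defSet (φ i) F v) p).ncard : ℝ) := by
        rw [hψ i F v p, ncard_setOf_apply_zero_mem]
      have hlt' : (C i : ℝ) < ((lastFibre (defSet (φ i) F v) p).ncard : ℝ) := by
        have h1 := (hasMoreThan_iff_lt_ncard (Set.toFinite _)).1 hp
        calc C i ≤ (c₀ : ℝ) := hc₀ i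
          _ < _ := by exact_mod_cast h1
      rcases hdich i F (Sum.elim p v) with h | h
      · rw [hfib] at h
        exact absurd h (not_le.2 hlt')
      · rw [hfib] at h
        refine le_trans ?_ h
        exact mul_le_mul_of_nonneg_right ((min_le_left _ _).trans (hδ₁le i)) (Nat.cast_nonneg _)
    · rw [← hψ₀ i F v]
      exact ((goodThresholds_congr hlt _).2 (hgood' (Sum.inl i) F v)).anti (min_le_right _ _)
    · rw [← hψ₁ i F v]
      exact ((goodThresholds_congr hlt _).2 (hgood' (Sum.inr i) F v)).anti (min_le_right _ _)

/-- **Good thresholds exist for one definable family.**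
[cite: ChatzidakisVanDenDriesMacintyre1992, Main Theorem] -/
theorem exists_goodThresholds₁ (hCDM : ChatzidakisVanDenDriesMacintyre1992_mainTheorem) {n : ℕ}
    (φ : Language.ring.Formula (Fin n ⊕ γ)) :
    ∃ (Cs : ℕ → ℕ) (δ : ℝ), 0 < δ ∧ δ ≤ 1 ∧
      ∀ (F : Type) [Field F] [Fintype F] [CompatibleRing F] (v : γ → F),
        GoodThresholds Cs δ n (defSet φ F v) := by
  obtain ⟨Cs, δ, hδ, hδ1, h⟩ := exists_goodThresholds hCDM n (fun _ : Unit => φ)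
  exact ⟨Cs, δ, hδ, hδ1, h ()⟩

end Thresholds

/-! ### Pseudo-finite fields: agreement and permutation invariance -/

section Psf

variable {γ : Type} [Finite γ] {n : ℕ}

/-- **Algebraic boundedness with the good threshold**: in a pseudo-finite field, a fibre of a
definable family with more than `Cs n` points is infinite, when the thresholds are good in all
finite fields (transfer of "more than `Cs n` points ⇒ at least `δ q > M` points").
[cite: ChatzidakisVanDenDriesMacintyre1992, Main Theorem and (2.7)] -/
theorem infinite_lastFibre_of_hasMoreThan (φ : Language.ring.Formula (Fin (n + 1) ⊕ γ))
    {Cs : ℕ → ℕ} {δ : ℝ} (hδ : 0 < δ)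
    (hgood : ∀ (F : Type) [Field F] [Fintype F] [CompatibleRing F] (v : γ → F),
      GoodThresholds Cs δ (n + 1) (defSet φ F v))
    (K : Type) [Field K] [CompatibleRing K] [Infinite K] (hK : K ⊨ finiteFieldTheory)
    (v : γ → K) (p : Fin n → K) (hp : HasMoreThan (Cs n) (lastFibre (defSet φ K v) p)) :
    (lastFibre (defSet φ K v) p).Infinite := by
  intro hfin
  set N := (lastFibre (defSet φ K v) p).ncard with hN
  -- "more than `Cs n` points ⇒ more than `N` points" holds in all large finite fields
  obtain ⟨θC, hθC⟩ := definable_hasMoreThan_lastFibre (Cs n) φ (Sum.inl : Fin n → Fin n ⊕ γ) Sum.inr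
  obtain ⟨θN, hθN⟩ := definable_hasMoreThan_lastFibre N φ (Sum.inl : Fin n → Fin n ⊕ γ) Sum.inr
  have hfinF : ∀ (F : Type) [Field F] [Fintype F], ⌈((N : ℝ) + 1) / δ⌉₊ ≤ Fintype.card F →
      ∀ V : Fin n ⊕ γ → F, (letI := compatibleRingOfRing F; (θC.imp θN).Realize V) := by
    intro F _ _ hF V
    letI := compatibleRingOfRing F
    rw [Formula.realize_imp, hθC, hθN]
    intro hC
    have h1 := ((goodThresholds_succ _ _ _).1 (hgood F fun g => V (Sum.inr g))).1 _ hC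
    rw [hasMoreThan_iff_lt_ncard (Set.toFinite _)]
    have h2 : ((N : ℝ) + 1) / δ ≤ (Fintype.card F : ℝ) := (Nat.le_ceil _).trans (by exact_mod_cast hF)
    rw [div_le_iff₀ hδ] at h2
    have h3 : (N : ℝ) + 1 ≤ ((lastFibre (defSet φ F fun g => V (Sum.inr g)) fun i =>
        V (Sum.inl i)).ncard : ℝ) := by linarith
    exact_mod_cast h3
  have hKreal := realize_formula_of_forall_finite (θC.imp θN) _ hfinF K hK (Sum.elim p v)
  rw [Formula.realize_imp, hθC, hθN] at hKreal
  have hmore : HasMoreThan N (lastFibre (defSet φ K v) p) := hKreal hp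
  rw [hasMoreThan_iff_lt_ncard hfin] at hmore
  exact lt_irrefl _ hmore

/-- **Agreement of the intrinsic and the thresholded dimension on definable sets in a
pseudo-finite field**, for thresholds good in all finite fields: `DimAtLeast n X e ↔
CDimAtLeast Cs n X e` for `X = φ(K^n; v)`. [folklore]
[cite: ChatzidakisVanDenDriesMacintyre1992, Main Theorem and (2.7)] -/
theorem dimAtLeast_iff_cDimAtLeast (K : Type) [Field K] [CompatibleRing K] [Infinite K]
    (hK : K ⊨ finiteFieldTheory) :
    ∀ (n : ℕ) (φ : Language.ring.Formula (Fin n ⊕ γ)) {Cs : ℕ → ℕ} {δ : ℝ}, 0 < δ →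
      (∀ (F : Type) [Field F] [Fintype F] [CompatibleRing F] (v : γ → F),
        GoodThresholds Cs δ n (defSet φ F v)) →
      ∀ (v : γ → K) (e : ℕ), DimAtLeast n (defSet φ K v) e ↔ CDimAtLeast Cs n (defSet φ K v) e
  | 0, φ, Cs, δ, _, _, v, e => Iff.rfl
  | n + 1, φ, Cs, δ, hδ, hgood, v, e => by
    have hinf : infBase (defSet φ K v) = cinfBase (Cs n) (defSet φ K v) := Set.ext fun p =>
      ⟨fun h => Set.Infinite.hasMoreThan h _, fun h => infinite_lastFibre_of_hasMoreThan φ hδ hgood K hK v p h⟩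
    have hfin : finBase (defSet φ K v) = cfinBase (Cs n) (defSet φ K v) := Set.ext fun p =>
      ⟨fun h => ⟨h.2, fun hm => infinite_lastFibre_of_hasMoreThan φ hδ hgood K hK v p hm h.1⟩,
        fun h => ⟨Set.not_infinite.1 fun hi => h.2 (Set.Infinite.hasMoreThan hi _), h.1⟩⟩
    obtain ⟨ψ₀, hψ₀⟩ := exists_formula_cfinBase (Cs n) φ
    obtain ⟨ψ₁, hψ₁⟩ := exists_formula_cinfBase (Cs n) φ
    have hgood₀ : ∀ (F : Type) [Field F] [Fintype F] [CompatibleRing F] (v : γ → F),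
        GoodThresholds Cs δ n (defSet ψ₀ F v) := fun F _ _ _ v => by
      rw [hψ₀]; exact ((goodThresholds_succ _ _ _).1 (hgood F v)).2.1
    have hgood₁ : ∀ (F : Type) [Field F] [Fintype F] [CompatibleRing F] (v : γ → F),
        GoodThresholds Cs δ n (defSet ψ₁ F v) := fun F _ _ _ v => by
      rw [hψ₁]; exact ((goodThresholds_succ _ _ _).1 (hgood F v)).2.2
    rw [dimAtLeast_succ, cDimAtLeast_succ, hinf, hfin, ← hψ₀ K v, ← hψ₁ K v,
      dimAtLeast_iff_cDimAtLeast K hK n ψ₀ hδ hgood₀ v e,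
      dimAtLeast_iff_cDimAtLeast K hK n ψ₁ hδ hgood₁ v (e - 1)]

/-- **The intrinsic dimension of a definable set is first-order in a pseudo-finite field**: a
formula `θ_e(v)` (built with thresholds good in all finite fields) with
`K ⊨ θ_e(v) ↔ DimAtLeast n (φ(K^n; v)) e` in every pseudo-finite `K`, and
`F ⊨ θ_e(v) ↔ CDimAtLeast Cs n (φ(F^n; v)) e` in every field. [folklore]
[cite: ChatzidakisVanDenDriesMacintyre1992, Main Theorem and (2.7)] -/
theorem exists_formula_dimAtLeast (hCDM : ChatzidakisVanDenDriesMacintyre1992_mainTheorem)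
    (φ : Language.ring.Formula (Fin n ⊕ γ)) (e : ℕ) :
    ∃ (Cs : ℕ → ℕ) (δ : ℝ) (θ : Language.ring.Formula γ), 0 < δ ∧ δ ≤ 1 ∧
      (∀ (F : Type) [Field F] [Fintype F] [CompatibleRing F] (v : γ → F),
        GoodThresholds Cs δ n (defSet φ F v)) ∧
      (∀ (K : Type) [Field K] [CompatibleRing K] (v : γ → K),
        θ.Realize v ↔ CDimAtLeast Cs n (defSet φ K v) e) ∧
      ∀ (K : Type) [Field K] [CompatibleRing K] [Infinite K], K ⊨ finiteFieldTheory →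
        ∀ v : γ → K, θ.Realize v ↔ DimAtLeast n (defSet φ K v) e := by
  obtain ⟨Cs, δ, hδ, hδ1, hgood⟩ := exists_goodThresholds₁ hCDM φ
  obtain ⟨θ, hθ⟩ := exists_formula_cDimAtLeast Cs n φ e
  exact ⟨Cs, δ, θ, hδ, hδ1, hgood, hθ, fun K _ _ _ hK v =>
    (hθ K v).trans (dimAtLeast_iff_cDimAtLeast K hK n φ hδ hgood v e).symm⟩

/-- Precomposition with a permutation does not change the number of points. [folklore] -/
theorem ncard_setOf_comp_perm_mem {K : Type*} (X : Set (Fin n → K)) (σ : Equiv.Perm (Fin n)) :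
    {x : Fin n → K | x ∘ σ ∈ X}.ncard = X.ncard := by
  have hinj : Function.Injective fun x : Fin n → K => x ∘ σ := fun x y h =>
    funext fun i => by simpa using congrFun h (σ.symm i)
  have hrange : X ⊆ Set.range fun x : Fin n → K => x ∘ σ := fun x _ =>
    ⟨x ∘ σ.symm, funext fun i => by simp⟩
  exact Set.ncard_preimage_of_injective_subset_range hinj hrange

/-- Precomposition with a permutation preserves nonemptiness. [folklore] -/
theorem setOf_comp_perm_mem_nonempty_iff {K : Type*} (X : Set (Fin n → K))
    (σ : Equiv.Perm (Fin n)) : {x : Fin n → K | x ∘ σ ∈ X}.Nonempty ↔ X.Nonempty :=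
  ⟨fun ⟨x, hx⟩ => ⟨_, hx⟩, fun ⟨x, hx⟩ => ⟨x ∘ σ.symm, by
    rw [Set.mem_setOf_eq]; convert hx using 1; funext i; simp⟩⟩

/-- **Transfer step for permutation invariance**: in a finite field large enough, the
thresholded dimensions of `X = φ(F^n; v)` and of `σX` (each with its own good thresholds)
agree, because both are read off from `|X| = |σX|` by the counting estimates. [folklore] -/
theorem cDimAtLeast_perm_iff_of_card_le {F : Type} [Field F] [Fintype F] [CompatibleRing F]
    {Cs Cs' : ℕ → ℕ} {δ δ' : ℝ} (hδ : 0 < δ) (hδ1 : δ ≤ 1) (hδ' : 0 < δ') (hδ'1 : δ' ≤ 1)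
    {X X' : Set (Fin n → F)} (hgood : GoodThresholds Cs δ n X) (hgood' : GoodThresholds Cs' δ' n X')
    (hcard : X.ncard = X'.ncard) (hne : X.Nonempty ↔ X'.Nonempty)
    (hF : ⌊(thresholdBound Cs' n : ℝ) / δ ^ n⌋₊ + ⌊(thresholdBound Cs n : ℝ) / δ' ^ n⌋₊ + 1 ≤
      Fintype.card F) (e : ℕ) :
    CDimAtLeast Cs n X e ↔ CDimAtLeast Cs' n X' e := by
  have hq0 : (0 : ℝ) < (Fintype.card F : ℝ) := by exact_mod_cast Fintype.card_pos
  have hFr : (⌊(thresholdBound Cs' n : ℝ) / δ ^ n⌋₊ : ℝ) + ⌊(thresholdBound Cs n : ℝ) / δ' ^ n⌋₊ + 1 ≤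
      (Fintype.card F : ℝ) := by exact_mod_cast hF
  -- one direction of the argument, for either pair of thresholds
  have key : ∀ {Cs Cs' : ℕ → ℕ} {δ δ' : ℝ}, 0 < δ → δ ≤ 1 → ∀ {X X' : Set (Fin n → F)},
      GoodThresholds Cs δ n X → GoodThresholds Cs' δ' n X' → X.ncard = X'.ncard →
      (X.Nonempty → X'.Nonempty) →
      (thresholdBound Cs' n : ℝ) / δ ^ n < (Fintype.card F : ℝ) →
      CDimAtLeast Cs n X e → CDimAtLeast Cs' n X' e := by
    intro Cs Cs' δ δ' hδ hδ1 X X' hgood hgood' hcard hne hlt h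
    rcases Nat.eq_zero_or_pos e with rfl | he
    · rw [cDimAtLeast_zero_iff] at h ⊢
      exact hne h
    · obtain ⟨e', rfl⟩ : ∃ e', e = e' + 1 := ⟨e - 1, by omega⟩
      by_contra hcon
      have hlow := le_ncard_of_cDimAtLeast hδ hδ1 hgood h
      have hup := ncard_le_of_not_cDimAtLeast hgood' hcon
      rw [← hcard] at hup
      have hδn : (0 : ℝ) < δ ^ n := pow_pos hδ n
      have hqe : (0 : ℝ) < (Fintype.card F : ℝ) ^ e' := pow_pos hq0 e'
      -- `δ^n q^{e'+1} ≤ M' q^{e'}`, so `q ≤ M'/δ^n`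
      have h1 : δ ^ n * (Fintype.card F : ℝ) * (Fintype.card F : ℝ) ^ e' ≤
          (thresholdBound Cs' n : ℝ) * (Fintype.card F : ℝ) ^ e' := by
        calc δ ^ n * (Fintype.card F : ℝ) * (Fintype.card F : ℝ) ^ e'
            = δ ^ n * (Fintype.card F : ℝ) ^ (e' + 1) := by ring
          _ ≤ _ := hlow.trans hup
      have h2 : δ ^ n * (Fintype.card F : ℝ) ≤ (thresholdBound Cs' n : ℝ) :=
        le_of_mul_le_mul_right h1 hqe
      have h3 : (Fintype.card F : ℝ) ≤ (thresholdBound Cs' n : ℝ) / δ ^ n := by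
        rw [le_div_iff₀ hδn]; linarith [mul_comm (δ ^ n) (Fintype.card F : ℝ)]
      linarith
  constructor
  · refine key hδ hδ1 hgood hgood' hcard hne.1 ?_
    have := Nat.lt_floor_add_one ((thresholdBound Cs' n : ℝ) / δ ^ n)
    linarith [Nat.cast_nonneg (α := ℝ) ⌊(thresholdBound Cs n : ℝ) / δ' ^ n⌋₊]
  · refine key hδ' hδ'1 hgood' hgood hcard.symm hne.2 ?_
    have := Nat.lt_floor_add_one ((thresholdBound Cs n : ℝ) / δ' ^ n)
    linarith [Nat.cast_nonneg (α := ℝ) ⌊(thresholdBound Cs' n : ℝ) / δ ^ n⌋₊]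

/-- **Permutation invariance of the dimension of definable sets in pseudo-finite fields**: for
`X = φ(K^n; v)` and a permutation `σ` of the coordinates, `σX = {x | x ∘ σ ∈ X}` has dimension
`≥ e` iff `X` has.  (False for arbitrary sets; here by transfer of `|σX| = |X|` from finite
fields through the counting estimates and the agreement theorem.) [folklore]
[cite: ChatzidakisVanDenDriesMacintyre1992, Main Theorem and (2.7)] -/
theorem dimAtLeast_preimage_perm_iff (hCDM : ChatzidakisVanDenDriesMacintyre1992_mainTheorem)
    (K : Type) [Field K] [CompatibleRing K] [Infinite K] (hK : K ⊨ finiteFieldTheory)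
    (φ : Language.ring.Formula (Fin n ⊕ γ)) (σ : Equiv.Perm (Fin n)) (v : γ → K) (e : ℕ) :
    DimAtLeast n {x | x ∘ σ ∈ defSet φ K v} e ↔ DimAtLeast n (defSet φ K v) e := by
  -- thresholds and formulas for `φ` and for the permuted formula
  obtain ⟨Cs, δ, θ, hδ, hδ1, hgood, hθ, hθK⟩ := exists_formula_dimAtLeast hCDM φ e
  obtain ⟨Cs', δ', θ', hδ', hδ'1, hgood', hθ', hθK'⟩ :=
    exists_formula_dimAtLeast hCDM (φ.relabel (Sum.map σ id)) e
  -- in large finite fields the two formulas are equivalent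
  have hfin : ∀ (F : Type) [Field F] [Fintype F],
      ⌊(thresholdBound Cs' n : ℝ) / δ ^ n⌋₊ + ⌊(thresholdBound Cs n : ℝ) / δ' ^ n⌋₊ + 1 ≤
        Fintype.card F →
      ∀ w : γ → F, (letI := compatibleRingOfRing F; (θ.iff θ').Realize w) := by
    intro F _ _ hF w
    letI := compatibleRingOfRing F
    rw [Formula.realize_iff, hθ, hθ']
    refine cDimAtLeast_perm_iff_of_card_le hδ hδ1 hδ' hδ'1 (hgood F w) (hgood' F w) ?_ ?_ hF e
    · rw [defSet_relabel_perm, ncard_setOf_comp_perm_mem]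
    · rw [defSet_relabel_perm, setOf_comp_perm_mem_nonempty_iff]
  have hKiff := realize_formula_of_forall_finite (θ.iff θ') _ hfin K hK v
  rw [Formula.realize_iff, hθK K hK, hθK' K hK, defSet_relabel_perm] at hKiff
  exact hKiff.symm

end Psf

end Literature.ModelTheory.PseudofiniteFields
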